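import Mathlib.RingTheory.Smooth.StandardSmoothCotangent
import Mathlib.RingTheory.Smooth.AdicCompletion
import Mathlib.RingTheory.Extension.Presentation.Submersive
import Mathlib.RingTheory.Localization.Away.Basic
import Mathlib.RingTheory.LocalRing.ResidueField.Basic
import Mathlib.Algebra.MvPolynomial.PDeriv
import HarnessLib

/-!
# [OURS · L1 W4.5(b) · EL♮(3) · nose residue, door ν4 «EQUINODAL PLANAR NOSE», brick (D6-1) file A]
# The SQUARE MULTIVARIATE HENSEL LEMMA over an adically complete ring (Jacobian criterion ⇒ exact root)

Cell `res-hironaka`, LADDER-RESOLUTION rung L (D-0089), slot W4.5(b), crux chain w45b: child crux **EL♮(3)** =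
stmt-ResolutionOfSingularities-20148 (parent EL♮ = stmt-…-20038); registered nose residue of record
`stub_elnat_three_nonisolated_nonUnobsNonHostedNestNoseBTriplePrime` (39th registration, CHILD v45 d73c58dccb65cdf1).
WIDTH seat res-L1-w45b-nose-w1 g3 (D-0157 DOOR 1), desk RULING R52 / WIDTH TABLE D6 row **(D6-1)**: the (S1) supplier
`exists_equinodal_lift` of NU4-SIZING v5 f7486aab0e6e06a9 (§0 (S1) items (m1)–(m5), §M M.2 (a)). This is file A of three:
the generic algebra engine behind (m3)–(m4). `--supports stmt-ResolutionOfSingularities-20148 --as helper`, counted 0.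
OURS; NOT a statement of H. Hironaka's 2017 manuscript (nothing of [Hironaka2017] is asserted); AI-written, AI review
weaker than expert review. DEF-FREE; no `sorry`; standard axioms. EL♮(3) is NOT proved here; resolution in positive
characteristic is NOT proved here (dimension 3 is Cossart–Piltant 2008/2009 in print).

WHAT. `SquareHensel.exists_lift_of_isUnit_jacobian`: `O` a commutative ring complete and separated for the `I`-adic
topology (`IsAdicComplete I O`), `F : N → O[Xₙ : n ∈ N]` a SQUARE polynomial system (`N` finite), `x₀ : N → O` with
`F i (x₀) ∈ I` for all `i` and `det (∂F_j/∂X_i)(x₀)` a unit modulo `I` ⇒ an exact root `x ≡ x₀ (mod I)`.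
`SquareHensel.exists_lift_of_residue`: the local form — `O` local, complete for `𝔪`, a point `x̄` of the residue field
with `F̄(x̄) = 0` and `det (∂F̄_i/∂X_j)(x̄) ≠ 0` ⇒ a root `x` of `F` with `residue ∘ x = x̄`.

HOW (Mathlib BY NAME, no new mathematics). `T := (O[X] ⧸ (F))[1/jac]` carries the composite of the naive pre-submersive
presentation of the quotient (`Algebra.PreSubmersivePresentation.naive`, pivot map `id`, Jacobi matrix `∂F_j/∂X_i` by
`jacobiMatrix_naive`) with the presentation of the localisation away from its own Jacobian
(`PreSubmersivePresentation.localizationAway`); by `comp_jacobian_eq_jacobian_smul_jacobian` and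
`localizationAway_jacobian` the composite Jacobian is `jac · jac`, a unit in `T`, so the composite is a
`SubmersivePresentation`, `T` is standard smooth (`SubmersivePresentation.isStandardSmooth`) hence `Algebra.Smooth`
hence formally smooth over `O`; the `O`-algebra map `T → O ⧸ I` defined by `x₀` (`Ideal.Quotient.liftₐ`,
`IsLocalization.Away.liftAlgHom`) lifts to `T → O` by `Algebra.FormallySmooth.exists_mkₐ_comp_eq_of_isAdicComplete`,
and the images of the variables are the root. The local form chooses any lift of `x̄` and moves `residue` through
`eval`, `pderiv` (`pderiv_map`) and `det` (`RingHom.map_det`).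

References (index only): N. Bourbaki, *Algèbre commutative* III §4 no. 5 Cor. 2 (Hensel for systems); A. Grothendieck,
EGA IV 18.5.17 (formal smoothness and lifting of points); J.-C. Tougeron, *Idéaux de fonctions différentiables* (1972)
III §3 (implicit functions). [folklore]
-/

set_option linter.dupNamespace false

noncomputable section

open MvPolynomial

namespace Summit.ResolutionOfSingularities.ResolutionOfSingularities.Cruxes.EquisingularLiftNat.Sections.SquareHensel

/-- **Square multivariate Hensel lemma (Jacobian criterion + formal smoothness).** Let `O` be a commutative ring,
complete and separated for the `I`-adic topology, `F : N → O[Xₙ : n ∈ N]` a square polynomial system (`N` finite) and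
`x₀ : N → O` an approximate root: `F i (x₀) ∈ I` for all `i`, with the Jacobian determinant `det (∂F_j/∂X_i)(x₀)` a unit
modulo `I`. Then there is an exact root `x` of the system congruent to `x₀` modulo `I`.
Proof: the `O`-algebra `T := (O[X] ⧸ (F))[1/jac]` is standard smooth (Mathlib: the naive pre-submersive presentation of the
quotient composed with the presentation of the localisation away from its own Jacobian has Jacobian `jac²`, a unit), hence
formally smooth, so the `O`-algebra map `T → O ⧸ I` defined by `x₀` lifts to `T → O`
(`Algebra.FormallySmooth.exists_mkₐ_comp_eq_of_isAdicComplete`); the images of the variables are the root. [folklore: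
Bourbaki, *Alg. Comm.* III §4 no. 5 Cor. 2; EGA 0_IV 19.3.10 / IV 18.5.17 («Hensel–Tougeron»)] -/
theorem exists_lift_of_isUnit_jacobian
    {O : Type*} [CommRing O] {I : Ideal O} [IsAdicComplete I O]
    {N : Type*} [Fintype N] [DecidableEq N]
    (F : N → MvPolynomial N O) (x₀ : N → O)
    (hF : ∀ i, Ideal.Quotient.mk I (eval x₀ (F i)) = 0)
    (hJ : IsUnit (Ideal.Quotient.mk I
      (eval x₀ (Matrix.det (Matrix.of fun i j : N => pderiv i (F j)))))) :
    ∃ x : N → O, (∀ i, Ideal.Quotient.mk I (x i) = Ideal.Quotient.mk I (x₀ i)) ∧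
      ∀ i, eval x (F i) = 0 := by
  classical
  -- the quotient algebra `S = O[X] ⧸ (F)` with its naive pre-submersive presentation (pivot map `id`)
  set J : Ideal (MvPolynomial N O) := Ideal.span (Set.range F) with hJdef
  let P : Algebra.PreSubmersivePresentation O (MvPolynomial N O ⧸ J) N N :=
    Algebra.PreSubmersivePresentation.naive (v := F) id Function.injective_id
  have hmat : P.jacobiMatrix = Matrix.of (fun i j : N => pderiv i (F j)) := by
    refine Matrix.ext fun i j => ?_
    rw [Matrix.of_apply]
    exact Algebra.PreSubmersivePresentation.jacobiMatrix_naive (v := F) id Function.injective_id _ _ i j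
  have halg : ∀ p : MvPolynomial N O,
      algebraMap P.Ring (MvPolynomial N O ⧸ J) p = Ideal.Quotient.mk J p := fun p => rfl
  have hPjac : P.jacobian = Ideal.Quotient.mk J (Matrix.det (Matrix.of fun i j : N => pderiv i (F j))) := by
    rw [P.jacobian_eq_jacobiMatrix_det, halg, hmat]
  -- the localisation `T = S[1/jac]` and the composite presentation over `O`, which is submersive
  let T := Localization.Away P.jacobian
  let Q : Algebra.PreSubmersivePresentation (MvPolynomial N O ⧸ J) T Unit Unit :=
    Algebra.PreSubmersivePresentation.localizationAway T P.jacobian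
  have hunit : IsUnit (Q.comp P).jacobian := by
    rw [Algebra.PreSubmersivePresentation.comp_jacobian_eq_jacobian_smul_jacobian,
      Algebra.PreSubmersivePresentation.localizationAway_jacobian, Algebra.smul_def]
    exact (IsLocalization.Away.algebraMap_isUnit P.jacobian).mul
      (IsLocalization.Away.algebraMap_isUnit P.jacobian)
  let QP : Algebra.SubmersivePresentation O T (Unit ⊕ N) (Unit ⊕ N) :=
    { toPreSubmersivePresentation := Q.comp P, jacobian_isUnit := hunit }
  haveI : Algebra.IsStandardSmooth O T := QP.isStandardSmooth
  haveI : Algebra.FormallySmooth O T := inferInstance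
  -- the `O ⧸ I`-point of `T` defined by `x₀`
  let ev₀ : MvPolynomial N O →ₐ[O] O ⧸ I := (Ideal.Quotient.mkₐ O I).comp (MvPolynomial.aeval x₀)
  have hev₀ : ∀ p ∈ J, ev₀ p = 0 := by
    have hle : J ≤ RingHom.ker (ev₀ : MvPolynomial N O →+* O ⧸ I) := by
      rw [hJdef, Ideal.span_le]
      rintro _ ⟨i, rfl⟩
      simp only [SetLike.mem_coe, RingHom.mem_ker]
      simpa [ev₀, coe_aeval_eq_eval] using hF i
    intro p hp
    exact hle hp
  let f₁ : (MvPolynomial N O ⧸ J) →ₐ[O] O ⧸ I := Ideal.Quotient.liftₐ J ev₀ hev₀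
  have hf₁ : ∀ p, f₁ (Ideal.Quotient.mk J p) = ev₀ p := fun p => rfl
  have hf₁jac : IsUnit (f₁ P.jacobian) := by
    rw [hPjac, hf₁]
    simpa [ev₀, coe_aeval_eq_eval] using hJ
  let f₂ : T →ₐ[O] O ⧸ I := IsLocalization.Away.liftAlgHom (S := T) P.jacobian hf₁jac
  have hf₂ : ∀ s, f₂ (algebraMap _ T s) = f₁ s := fun s =>
    IsLocalization.Away.lift_eq (S := T) P.jacobian hf₁jac s
  -- formal smoothness lifts the point to an `O`-point of `T`
  obtain ⟨g, hg⟩ := Algebra.FormallySmooth.exists_mkₐ_comp_eq_of_isAdicComplete (R := O) (I := I) f₂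
  refine ⟨fun n => g (algebraMap _ T (Ideal.Quotient.mk J (X n))), fun n => ?_, fun i => ?_⟩
  · have := congrArg (fun φ : T →ₐ[O] O ⧸ I => φ (algebraMap _ T (Ideal.Quotient.mk J (X n)))) hg
    simp only [AlgHom.comp_apply, Ideal.Quotient.mkₐ_eq_mk] at this
    rw [this, hf₂, hf₁]
    simp [ev₀]
  · -- `aeval x = g ∘ (S → T) ∘ (O[X] → S)` as `O`-algebra maps, and `F i ↦ 0` in `S`
    let ψ : MvPolynomial N O →ₐ[O] O :=
      g.comp ((IsScalarTower.toAlgHom O (MvPolynomial N O ⧸ J) T).comp (Ideal.Quotient.mkₐ O J))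
    have hψ : MvPolynomial.aeval (R := O)
        (fun n => g (algebraMap _ T (Ideal.Quotient.mk J (X n)))) = ψ := by
      refine MvPolynomial.algHom_ext fun n => ?_
      simp [ψ]
    have hFi : Ideal.Quotient.mk J (F i) = 0 :=
      Ideal.Quotient.eq_zero_iff_mem.mpr (hJdef ▸ Ideal.subset_span ⟨i, rfl⟩)
    rw [← coe_aeval_eq_eval, hψ]
    simp [ψ, hFi]

/-- **Local form.** For a local ring `O` complete for its maximal ideal, a square polynomial system `F : N → O[X]` and a
point `x̄` of the RESIDUE FIELD at which the reduced system vanishes with non-zero Jacobian determinant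
`det (∂F̄_i/∂X_j)(x̄)`, there is a root `x : N → O` of `F` reducing to `x̄`. [folklore] -/
theorem exists_lift_of_residue
    {O : Type*} [CommRing O] [IsLocalRing O] [IsAdicComplete (IsLocalRing.maximalIdeal O) O]
    {N : Type*} [Fintype N] [DecidableEq N]
    (F : N → MvPolynomial N O) (xbar : N → IsLocalRing.ResidueField O)
    (hF : ∀ i, eval xbar (map (IsLocalRing.residue O) (F i)) = 0)
    (hJ : (Matrix.of fun i j : N =>
        eval xbar (pderiv j (map (IsLocalRing.residue O) (F i)))).det ≠ 0) :
    ∃ x : N → O, (∀ i, IsLocalRing.residue O (x i) = xbar i) ∧ ∀ i, eval x (F i) = 0 := by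
  classical
  -- choose any lift `x₀` of `x̄`
  choose x₀ hx₀ using fun n => Ideal.Quotient.mk_surjective (I := IsLocalRing.maximalIdeal O) (xbar n)
  -- reduction commutes with evaluation: `residue ∘ eval x₀ = eval x̄ ∘ map residue`
  have hcomm : (IsLocalRing.residue O).comp (eval x₀) =
      (eval xbar).comp (map (IsLocalRing.residue O)) := by
    refine MvPolynomial.ringHom_ext (fun a => ?_) (fun n => ?_)
    · simp
    · simp [← hx₀]; rfl
  have hcomm' : ∀ p, IsLocalRing.residue O (eval x₀ p) = eval xbar (map (IsLocalRing.residue O) p) :=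
    fun p => RingHom.congr_fun hcomm p
  obtain ⟨x, hx, hroot⟩ := exists_lift_of_isUnit_jacobian (I := IsLocalRing.maximalIdeal O) F x₀
    (fun i => by
      change IsLocalRing.residue O _ = 0
      rw [hcomm', hF i])
    (by
      change IsUnit (IsLocalRing.residue O _)
      rw [hcomm', isUnit_iff_ne_zero]
      rw [RingHom.map_det, RingHom.map_det]
      convert (Matrix.det_transpose _).symm.trans_ne hJ using 2
      ext i j
      simp [pderiv_map])
  exact ⟨x, fun n => (hx n).trans (hx₀ n), hroot⟩

end Summit.ResolutionOfSingularities.ResolutionOfSingularities.Cruxes.EquisingularLiftNat.Sections.SquareHensel
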